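import Mathlib.Analysis.Real.Cardinality
import Mathlib.LinearAlgebra.Matrix.BilinearForm
import Mathlib.LinearAlgebra.Dimension.Constructions
import Mathlib.Tactic.Module
import Literature.AlgebraicGeometry.Surfaces.K3TwistorLines
import HarnessLib

/-!
# Crux `NikulinTwinTransport.TwinTwistorTransport` (stmt-HodgeConjecture-14393), line
# `mukai-lift-full-similitude`, stub `TwistorReach` — part A: bilinear algebra of twistor chains

Huybrechts, *Lectures on K3 Surfaces*, Ch. 7 §3.1 Prop. 3.2 ("any two points of the period domain
are equivalent", i.e. joined by a chain of GENERIC twistor lines) is stated for EVERY lattice of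
signature `(3, b − 3)`; the tree proves it for `Λ_{K3}` (`K3TwistorLines`,
`Huybrechts_K3_periodDomain_twistorConnected_holds`), with the purely bilinear steps typed on
`K3Index → ℝ`. The registered stub `TwistorReach` of the line `mukai-lift-full-similitude` is the
same proposition for the Mukai-lift lattice `Λ_{K3} ⊕ ⟨−2⟩` (period domain of `K3^{[2]}`-type,
Markman 2024 Def. 5.13). This file re-proves the bilinear-algebra steps of that argument for an
ARBITRARY real vector space `V` with a symmetric bilinear form `B` (proofs adapted line by line from
`K3TwistorLines`, whose lemmas are typed on `K3Index → ℝ` and cannot be instantiated elsewhere):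

* `twistorV_comb2`, `twistorV_comb3` — quadratic form of combinations;
* `twistorV_linearIndependent`, `twistorV_posFamily_of_orthogonal`, `twistorV_posFamily_of_perp` —
  positive triples;
* `twistorV_exists_orthogonal_mem_span` — inside a positive `3`-space there is a positive vector
  orthogonal to any two given vectors;
* `twistorV_exists_generic_perturbation` — the GENERIC POSITIVE COMPLETION of a positive plane:
  `c = n + ε g₀` is generic for all but countably many `ε` and `⟨a, b, c⟩` is positive for small `ε`
  (genericity abstracted to an arbitrary countable family `cast : L → V` and predicate `P`).

Part B (`…TwistorReachLattice`) specialises to integral lattices `ι → ℤ` with a Gram matrix and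
proves Prop. 3.2 for every non-degenerate integral lattice with a positive triple; part C
(`…TwistorReach`) transports it to `LiftLat = Λ_ℂ ⊕ ℂδ` and proves the registered stub.

References: [Huybrechts2016K3] Ch. 7 §3.1 Def. 3.1, Prop. 3.2 (after Beauville, Astérisque 126
(1985) Exp. VIII); [Markman2024] Def. 5.13.
-/

-- `Summit.HodgeConjecture.HodgeConjecture.…` (summit = problem) duplicates a namespace component by design (D-0017).
set_option linter.dupNamespace false

noncomputable section

namespace Summit.HodgeConjecture.HodgeConjecture.Theorems.TwinTwistorTransport.MukaiLift

open scoped BigOperators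

variable {V : Type*} [AddCommGroup V] [Module ℝ V]

/-- Quadratic form of a combination of two vectors, for a symmetric bilinear form. [folklore] -/
theorem twistorV_comb2 (B : LinearMap.BilinForm ℝ V) (hBs : ∀ u w, B u w = B w u)
    (s t : ℝ) (u v : V) :
    B (s • u + t • v) (s • u + t • v) = s * s * B u u + 2 * s * t * B u v + t * t * B v v := by
  simp only [LinearMap.BilinForm.add_left, LinearMap.BilinForm.add_right,
    LinearMap.BilinForm.smul_left, LinearMap.BilinForm.smul_right]
  rw [hBs v u]
  ring

/-- Quadratic form of a combination of three vectors, for a symmetric bilinear form. [folklore] -/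
theorem twistorV_comb3 (B : LinearMap.BilinForm ℝ V) (hBs : ∀ u w, B u w = B w u)
    (r s t : ℝ) (u v w : V) :
    B (r • u + s • v + t • w) (r • u + s • v + t • w) =
      r * r * B u u + s * s * B v v + t * t * B w w +
        2 * r * s * B u v + 2 * r * t * B u w + 2 * s * t * B v w := by
  simp only [LinearMap.BilinForm.add_left, LinearMap.BilinForm.add_right,
    LinearMap.BilinForm.smul_left, LinearMap.BilinForm.smul_right]
  rw [hBs v u, hBs w u, hBs w v]
  ring

/-- A bilinear form of a finite combination in the first variable. [folklore] -/
theorem twistorV_sum_smul_left (B : LinearMap.BilinForm ℝ V) (c : Fin 3 → ℝ)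
    (t : Fin 3 → V) (w : V) :
    B (∑ i, c i • t i) w = ∑ i, c i * B (t i) w := by
  rw [LinearMap.BilinForm.sum_left]
  simp only [LinearMap.BilinForm.smul_left]

/-- A triple on which a bilinear form is positive definite is linearly independent. [folklore] -/
theorem twistorV_linearIndependent (B : LinearMap.BilinForm ℝ V) {t : Fin 3 → V}
    (ht : ∀ c : Fin 3 → ℝ, c ≠ 0 → 0 < B (∑ i, c i • t i) (∑ i, c i • t i)) :
    LinearIndependent ℝ t := by
  rw [Fintype.linearIndependent_iff]
  intro c hc
  by_contra h
  push Not at h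
  obtain ⟨i, hi⟩ := h
  have hc0 : c ≠ 0 := fun h0 => hi (by simp [h0])
  have := ht c hc0
  rw [hc] at this
  simp at this

/-- The span of a positive triple has dimension `3`. [folklore] -/
theorem twistorV_finrank_span (B : LinearMap.BilinForm ℝ V) {t : Fin 3 → V}
    (ht : ∀ c : Fin 3 → ℝ, c ≠ 0 → 0 < B (∑ i, c i • t i) (∑ i, c i • t i)) :
    Module.finrank ℝ (Submodule.span ℝ (Set.range t)) = 3 := by
  rw [finrank_span_eq_card (twistorV_linearIndependent B ht), Fintype.card_fin]

/-- Every non-zero vector of the span of a positive triple has positive square. [folklore] -/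
theorem twistorV_pos_of_mem_span (B : LinearMap.BilinForm ℝ V) {t : Fin 3 → V}
    (ht : ∀ c : Fin 3 → ℝ, c ≠ 0 → 0 < B (∑ i, c i • t i) (∑ i, c i • t i))
    {w : V} (hw : w ∈ Submodule.span ℝ (Set.range t)) (hw0 : w ≠ 0) : 0 < B w w := by
  obtain ⟨c, rfl⟩ := (Submodule.mem_span_range_iff_exists_fun ℝ).1 hw
  have hc : c ≠ 0 := by
    rintro rfl
    exact hw0 (by simp)
  exact ht c hc

/-- An orthogonal triple of positive vectors is a positive triple (for a symmetric form).
[folklore] -/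
theorem twistorV_posFamily_of_orthogonal (B : LinearMap.BilinForm ℝ V)
    (hBs : ∀ u w, B u w = B w u) {u v w : V} (huv : B u v = 0) (huw : B u w = 0)
    (hvw : B v w = 0) (hu : 0 < B u u) (hv : 0 < B v v) (hw : 0 < B w w) :
    ∀ c : Fin 3 → ℝ, c ≠ 0 → 0 < B (∑ i, c i • ![u, v, w] i) (∑ i, c i • ![u, v, w] i) := by
  intro c hc
  have hsum : ∑ i, c i • ![u, v, w] i = c 0 • u + c 1 • v + c 2 • w := by
    simp [Fin.sum_univ_three]
  rw [hsum, twistorV_comb3 B hBs, huv, huw, hvw]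
  simp only [mul_zero, add_zero]
  have h0 : 0 ≤ c 0 * c 0 * B u u := mul_nonneg (mul_self_nonneg _) hu.le
  have h1 : 0 ≤ c 1 * c 1 * B v v := mul_nonneg (mul_self_nonneg _) hv.le
  have h2 : 0 ≤ c 2 * c 2 * B w w := mul_nonneg (mul_self_nonneg _) hw.le
  by_contra hle
  have hle := not_lt.mp hle
  have e0 : c 0 * c 0 * B u u = 0 := by linarith
  have e1 : c 1 * c 1 * B v v = 0 := by linarith
  have e2 : c 2 * c 2 * B w w = 0 := by linarith
  have c0 : c 0 = 0 := by
    rcases mul_eq_zero.1 e0 with h | h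
    · exact mul_self_eq_zero.1 h
    · exact absurd h hu.ne'
  have c1 : c 1 = 0 := by
    rcases mul_eq_zero.1 e1 with h | h
    · exact mul_self_eq_zero.1 h
    · exact absurd h hv.ne'
  have c2 : c 2 = 0 := by
    rcases mul_eq_zero.1 e2 with h | h
    · exact mul_self_eq_zero.1 h
    · exact absurd h hw.ne'
  exact hc (funext fun i => by fin_cases i <;> simp [c0, c1, c2])

/-- **Positivity of `⟨a, b, w⟩` from the orthogonal component**: if `a ⊥ b` are positive and the
component `w'` of `w` orthogonal to `⟨a, b⟩` has `(w'.w') > 0`, then `(a, b, w)` is a positive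
triple (for a symmetric form). [cite: Huybrechts2016K3, Ch. 7 §3.1 (proof of Prop. 3.2)] -/
theorem twistorV_posFamily_of_perp (B : LinearMap.BilinForm ℝ V)
    (hBs : ∀ u w, B u w = B w u) {a b w : V} (hab : B a b = 0) (ha : 0 < B a a)
    (hb : 0 < B b b)
    (hw : 0 < B (w - (B w a / B a a) • a - (B w b / B b b) • b)
      (w - (B w a / B a a) • a - (B w b / B b b) • b)) :
    ∀ c : Fin 3 → ℝ, c ≠ 0 → 0 < B (∑ i, c i • ![a, b, w] i) (∑ i, c i • ![a, b, w] i) := by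
  set l := B w a / B a a with hl
  set m := B w b / B b b with hm
  set w' := w - l • a - m • b with hw'
  have hba : B b a = 0 := by rw [hBs, hab]
  have hw'a : B a w' = 0 := by
    rw [hw', LinearMap.BilinForm.sub_right, LinearMap.BilinForm.sub_right,
      LinearMap.BilinForm.smul_right, LinearMap.BilinForm.smul_right, hab, hl,
      div_mul_cancel₀ _ ha.ne', hBs a w]
    ring
  have hw'b : B b w' = 0 := by
    rw [hw', LinearMap.BilinForm.sub_right, LinearMap.BilinForm.sub_right,
      LinearMap.BilinForm.smul_right, LinearMap.BilinForm.smul_right, hba, hm,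
      div_mul_cancel₀ _ hb.ne', hBs b w]
    ring
  have hpos := twistorV_posFamily_of_orthogonal B hBs hab hw'a hw'b ha hb hw
  intro c hc
  set c' : Fin 3 → ℝ := ![c 0 + c 2 * l, c 1 + c 2 * m, c 2] with hc'
  have hcomb : ∑ i, c i • ![a, b, w] i = ∑ i, c' i • ![a, b, w'] i := by
    simp only [Fin.sum_univ_three, hc', hw']
    simp only [Matrix.cons_val_zero, Matrix.cons_val_one, Matrix.cons_val_two, Matrix.head_cons,
      Matrix.tail_cons]
    module
  have hc'0 : c' ≠ 0 := by
    intro h0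
    have h2 : c 2 = 0 := by simpa [hc'] using congrFun h0 2
    have h0' : c 0 = 0 := by simpa [hc', h2] using congrFun h0 0
    have h1 : c 1 = 0 := by simpa [hc', h2] using congrFun h0 1
    exact hc (funext fun i => by fin_cases i <;> simp [h0', h1, h2])
  rw [hcomb]
  exact hpos c' hc'0

/-- In the span `W` of a triple on which `B` is positive definite there is, for any two vectors
`u₁, u₂ ∈ V`, a vector `m ∈ W ∩ ⟨u₁, u₂⟩^⊥` with `B m m > 0` (`dim W = 3 > 2`). [folklore] -/
theorem twistorV_exists_orthogonal_mem_span (B : LinearMap.BilinForm ℝ V)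
    (t : Fin 3 → V)
    (ht : ∀ c : Fin 3 → ℝ, c ≠ 0 → 0 < B (∑ i, c i • t i) (∑ i, c i • t i))
    (u₁ u₂ : V) :
    ∃ m ∈ Submodule.span ℝ (Set.range t), B m u₁ = 0 ∧ B m u₂ = 0 ∧ 0 < B m m := by
  classical
  let M : Matrix (Fin 3) (Fin 3) ℝ := Matrix.of fun j i => ![B (t i) u₁, B (t i) u₂, (0 : ℝ)] j
  have hdet : M.det = 0 := Matrix.det_eq_zero_of_row_eq_zero 2 (fun i => by simp [M])
  obtain ⟨c, hc, hMc⟩ := Matrix.exists_mulVec_eq_zero_iff.2 hdet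
  have h₁ : ∑ i, c i * B (t i) u₁ = 0 := by
    have h := congrFun hMc 0
    simp only [M, Matrix.mulVec, dotProduct, Matrix.of_apply, Pi.zero_apply,
      Matrix.cons_val_zero] at h
    rw [← h]
    exact Finset.sum_congr rfl fun i _ => mul_comm _ _
  have h₂ : ∑ i, c i * B (t i) u₂ = 0 := by
    have h := congrFun hMc 1
    simp only [M, Matrix.mulVec, dotProduct, Matrix.of_apply, Pi.zero_apply,
      Matrix.cons_val_one] at h
    rw [← h]
    exact Finset.sum_congr rfl fun i _ => mul_comm _ _
  refine ⟨∑ i, c i • t i, ?_, ?_, ?_, ht c hc⟩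
  · exact Submodule.sum_mem _ fun i _ =>
      Submodule.smul_mem _ _ (Submodule.subset_span (Set.mem_range_self i))
  · rw [twistorV_sum_smul_left, h₁]
  · rw [twistorV_sum_smul_left, h₂]

/-- **Generic positive completion of a positive plane** (the choice "pick `c` such that
`⟨a, b, c⟩` is a positive three-space […] such that `c^⊥ ∩ Λ = 0`" of the printed proof), for a
symmetric bilinear form `B` on `V` and a COUNTABLE family `cast : L → V` of "lattice vectors" with a
target predicate `P` (intended: `L = Λ`, `P v = (v = 0)`): let `a ⊥ b` be positive vectors,
`n ⊥ a, b` with `B n n > 0`, and `g` a vector such that every lattice vector orthogonal to `g`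
satisfies `P`. Then for a suitable real `ε` the vector `c := n + ε g` has the same property (it
fails for at most countably many `ε`: one per lattice vector) and `(a, b, c)` is a positive triple
(true for all small `ε`). [cite: Huybrechts2016K3, Ch. 7 §3.1 (proof of Prop. 3.2)] -/
theorem twistorV_exists_generic_perturbation (B : LinearMap.BilinForm ℝ V)
    (hBs : ∀ u w, B u w = B w u) {L : Type*} [Countable L] (cast : L → V) (P : L → Prop)
    {a b n g : V}
    (hab : B a b = 0) (ha : 0 < B a a) (hb : 0 < B b b)
    (hna : B n a = 0) (hnb : B n b = 0) (hn : 0 < B n n)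
    (hg : ∀ v : L, B (cast v) g = 0 → P v) :
    ∃ ε : ℝ, (∀ v : L, B (cast v) (n + ε • g) = 0 → P v) ∧
      ∀ c : Fin 3 → ℝ, c ≠ 0 →
        0 < B (∑ i, c i • ![a, b, n + ε • g] i) (∑ i, c i • ![a, b, n + ε • g] i) := by
  -- the component of `g` orthogonal to `⟨a, b⟩`, and the size of the admissible interval
  set g' := g - (B g a / B a a) • a - (B g b / B b b) • b with hg'
  set K : ℝ := 2 * |B n g'| + |B g' g'| + 1 with hK
  have hK0 : 0 < K := by positivity
  have hδ0 : 0 < min 1 (B n n / K) := lt_min one_pos (div_pos hn hK0)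
  -- the countable set of bad parameters
  set C : Set ℝ := Set.range fun v : L => -B (cast v) n / B (cast v) g with hC
  have hCc : C.Countable := Set.countable_range _
  obtain ⟨ε, ⟨hε0, hεδ⟩, hεC⟩ :=
    Literature.AlgebraicGeometry.Surfaces.exists_mem_Ioo_notMem_of_countable hCc hδ0
  refine ⟨ε, ?_, ?_⟩
  · intro v hv
    by_contra hv0
    have hvg : B (cast v) g ≠ 0 := fun h => hv0 (hg v h)
    rw [LinearMap.BilinForm.add_right, LinearMap.BilinForm.smul_right] at hv
    apply hεC
    refine ⟨v, ?_⟩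
    rw [div_eq_iff hvg]
    linarith
  · have hε1 : ε ≤ 1 := hεδ.le.trans (min_le_left _ _)
    have hεK : ε * K < B n n := by
      have : ε < B n n / K := hεδ.trans_le (min_le_right _ _)
      rwa [lt_div_iff₀ hK0] at this
    apply twistorV_posFamily_of_perp B hBs hab ha hb
    have hperp : n + ε • g - (B (n + ε • g) a / B a a) • a - (B (n + ε • g) b / B b b) • b
        = n + ε • g' := by
      rw [LinearMap.BilinForm.add_left, LinearMap.BilinForm.smul_left, hna,
        LinearMap.BilinForm.add_left, LinearMap.BilinForm.smul_left, hnb, hg']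
      simp only [zero_add, mul_div_assoc]
      module
    have hexp : B (n + ε • g') (n + ε • g') =
        B n n + 2 * ε * B n g' + ε * ε * B g' g' := by
      have h1 : n + ε • g' = (1 : ℝ) • n + ε • g' := by rw [one_smul]
      rw [h1, twistorV_comb2 B hBs]
      ring
    rw [hperp, hexp]
    have hεε : ε * ε ≤ ε := by nlinarith
    have hQ1 : -(ε * |B n g'|) ≤ ε * B n g' := by
      have := mul_le_mul_of_nonneg_left (neg_abs_le (B n g')) hε0.le
      linarith
    have hR1 : -(ε * ε * |B g' g'|) ≤ ε * ε * B g' g' := by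
      have := mul_le_mul_of_nonneg_left (neg_abs_le (B g' g')) (mul_self_nonneg ε)
      linarith
    have hR2 : ε * ε * |B g' g'| ≤ ε * |B g' g'| :=
      mul_le_mul_of_nonneg_right hεε (abs_nonneg _)
    have hexpK : ε * K = 2 * (ε * |B n g'|) + ε * |B g' g'| + ε := by rw [hK]; ring
    linarith

/-- **Registered sub-goal `twistorGenericPerturbation`** (closed form of
`twistorV_exists_generic_perturbation` at universe `0`): the generic positive completion of a
positive plane relative to a countable family of lattice vectors.
[cite: Huybrechts2016K3, Ch. 7 §3.1 (proof of Prop. 3.2)] -/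
theorem twistorGenericPerturbation : ∀ {V : Type} [AddCommGroup V] [Module ℝ V] (B : LinearMap.BilinForm ℝ V), (∀ u w, B u w = B w u) → ∀ {L : Type} [Countable L] (cast : L → V) (P : L → Prop) {a b n g : V}, B a b = 0 → 0 < B a a → 0 < B b b → B n a = 0 → B n b = 0 → 0 < B n n → (∀ v : L, B (cast v) g = 0 → P v) → ∃ ε : ℝ, (∀ v : L, B (cast v) (n + ε • g) = 0 → P v) ∧ ∀ c : Fin 3 → ℝ, c ≠ 0 → 0 < B (∑ i, c i • ![a, b, n + ε • g] i) (∑ i, c i • ![a, b, n + ε • g] i) :=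
  fun B hBs _ _ cast P _ _ _ _ hab ha hb hna hnb hn hg =>
    twistorV_exists_generic_perturbation B hBs cast P hab ha hb hna hnb hn hg

end Summit.HodgeConjecture.HodgeConjecture.Theorems.TwinTwistorTransport.MukaiLift

end
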